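/-
Copyright: statement-level skeleton of a published paper (lit-balaban cell, Phase-2 proof seat p13, gen 12). No proof
claims beyond what the kernel checks below.
-/
import Literature.MathematicalPhysics.QuantumFieldTheory.BalabanImbrieJaffe1984to88.BIJ88PairingAllOrders5133
import Literature.Probability.LatticeModels.UrsellDerivation

/-!
# `BalabanImbrieJaffe1984to88.BIJ88CumulantAllOrders5133` — T. Bałaban, J. Imbrie, A. Jaffe, *Effective action and cluster
properties of the abelian Higgs model*, Commun. Math. Phys. **114** (1988) 257–315 [BalabanImbrieJaffe1988], §5.13
p. 305 [PDF 49]: **the `s`-derivatives of the NORMALIZED interpolated expectation `⟨H⟩_s` AT EVERY ORDER, CORRECTLY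
EVALUATED, as truncated (Ursell) functions** — the normalized / truncated packaging of
`BIJ88PairingAllOrders5133` (the unnormalized integral at every order) and the all-orders form of
`BIJ88SecondOrder5133` (order two).

The print (p. 305, *"After all derivatives are performed … The result is"*)
  `⟨Π_{i∈I}f(□_i)⟩_1 = Σ_{Γ⊂I}∫ds_Γ Σ_{pairings p of Γ} ⟨Π_γ[⟨□_{i_γ}Φ,Δ□_{j_γ}Φ⟩;] Π_i f(□_i)⟩_{s_Γ}`
is the FTC expansion of `⟨H⟩_s` whose `Γ`-th term is `∂/∂s_Γ⟨H⟩_{s}` at `s_l = 0 (l ∉ Γ)`, evaluated (as printed) by the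
truncated expectations of the two-cube vertices only; it fails at `|Γ| = 2` (`BIJ88PairingDisplay305.pairingDisplay_fails`,
GAPS.md G-C2-24).  THE CORRECT VALUE AT EVERY ORDER is formalized here as follows (tree sign `Δ = −Δ_print`).  Label the
cubes by `some i` and the observable `H` by `none`; for a finite label set `P ⊆ Option I` let `P̃ = {i | some i ∈ P}`
and

  `M_s(P) = ⟨P_{P̃}(s,·) · H^{[none ∈ P]}⟩_s`     (`pmoment`; `M_s(∅) = 1`),

the normalized moments of the corrected pairing polynomials `P_Γ = Σ_{σ ∈ smallParts Γ}(−1)^{|σ|}Π_{B∈σ}V_B` of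
`BIJ88PairingAllOrders5133` (sum over the set partitions of `Γ` into blocks of one or two cubes, `V_{{i}} = D_i(s,·)`,
`V_{{i,l}} = ⟨□_iΦ,Δ□_lΦ⟩`; the print keeps the two-cube blocks).  Let `Mᵀ_s = ursellOf M_s` be their Ursell
(truncated, connected) function (`Literature.Probability.LatticeModels.ursellOf`, Möbius inversion over set
partitions).  THEN, for `s ∈ [0,1]^I`, `j ∉ W̃`, `W ≠ ∅`:

  `∂/∂s_j|_s Mᵀ_{s[j↦u]}(W) = Mᵀ_s(W ∪ {some j})`     (`hasDerivAt_ursell_pmoment`),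

and `Mᵀ_s{none} = ⟨H⟩_s` (`dexp_empty`).  Consequently the family `Γ ↦ ∂Γ⟨H⟩(s) := Mᵀ_s(Γ ∪ {none})` (`dexp`) is the
family of iterated coordinate derivatives of `⟨H⟩_s` on the cube at every order (`hasDerivAt_dexp`, in the format of
p02 `BIJ88FTCExpansion305.ftc_expansion`'s hypothesis), i.e. in closed form (`UrsellExplicitFormula.ursellOf_eq_sum_setPartitions`)

  `∂/∂s_Γ ⟨H⟩_s = Σ_{π ∈ setPartitions(Γ ∪ {H})} (−1)^{|π|−1}(|π|−1)! Π_{P∈π} ⟨P_{P̃} H^{[H∈P]}⟩_s`,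

and likewise `Γ ↦ Mᵀ_s(Γ)` (no observable label; first term `Mᵀ_s{some i} = −⟨D_i⟩_s = ∂_i log N_1(s)`, `pmoment_some`)
is the family of derivatives of `log N_1`.  The two ingredients: the unnormalized theorem `∂_j∫P_ΓG dμ_s = ∫P_{Γ∪j}G dμ_s`
(`BIJ88PairingAllOrders5133.hasDerivAt_num_ppoly`, `G = H` or `1`), whence the quotient rule
`∂_jM(P) = M(P∪j) − M(P)M{j}` (`hasDerivAt_pmoment`), and the general fact that along such a tilt the derivative of an
Ursell function is the Ursell function with one more argument (`LatticeModels.hasDerivAt_ursellOf`).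

RELATION TO THE PRINT'S BRACKETS.  By the moment–cumulant formula the same number regroups as
`∂/∂s_Γ⟨H⟩_s = Σ_{σ ∈ smallParts Γ} (−1)^{|σ|} ⟨Π_{B∈σ}[V_B;] H⟩_s` (joint truncations of the block vertices and `H`),
which is the p. 305 display with the one-cube blocks restored; this regrouping identity is NOT formalized in this file —
it is the theorem `BIJ88CumulantRegrouping5133.dexp_eq_sum_smallParts` of the sequel (v1.1 note; via the general
`Literature.Probability.LatticeModels.ursellOf_sum_setPartitions`, truncation commutes with superpositions over block
structures); at order two it is `BIJ88SecondOrder5133.hasDerivAt_dexpect` (`−⟨[B_{ij};]H⟩ + κ₃(D_i,D_j,H)`, see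
`dexp_pair` below), and at order one p13 g6 `hasDerivAt_expectation_interp` (`−⟨[D_i;]H⟩`, `dexp_singleton`).

statement-level skeleton of published theorems with citation tags; proofs where landed; nothing here is a claim
about the Yang–Mills mass gap

PDF held: `paper:balaban1988-cmp114-bij-abelian-higgs-effective-action` (journal page = PDF page + 256).

CITATION HEADER (lean-in-tree rule).  lit-balaban cell (HOME `run/shared/lean/pub/lit-balaban/`), Phase 2, seat p13
gen 12; row **C2.Eq5.13.3-5.13.4** of `HOME/lit-balaban-r16/ROWS-C2-part2.md` (owner r16, referee ref-5; owner's flip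
condition 2026-08-22T05:08Z *"the corrected form AT EVERY ORDER (cumulant expansion over set partitions of Γ into blocks
≤ 2) + the corrected walk form after IBP"* — this file: the every-order cumulant (Ursell) form before integration by
parts; the post-IBP random-walk form is not addressed).  USED BY NAME, nothing restated: p13 g12
`BIJ88PairingAllOrders5133.{smallParts, ppoly, bvert, ppoly_empty, bvert_singleton, hasDerivAt_num_ppoly, num_ppoly_empty}`,
`BIJ88SecondOrder5133.{num, Dfun}`, `BIJ88PairingDisplay305.expect`; p13 g6 `BIJ88SDerivative305.integral_weight_mul_source_pos`;
p02 `BIJ88DirichletForms305.interpForm_posDef`; `Literature.Probability.LatticeModels.{ursellOf, ursellOf_singleton,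
hasDerivAt_ursellOf (UrsellDerivation), setPartitions_singleton}`.

## What is proved (0 `sorry`, standard axioms, no new `Prop` facts)

* `ppoly_singleton` (`P_{{i}} = −D_i`); `obs`, `obs_of_mem`, `obs_of_not_mem`, `obs_singleton_some`, `obs_insert_some`;
  private finset plumbing `eraseNone_insert_some`, `eraseNone_singleton_some`, `eraseNone_pair`, `insertNone_insert`,
  `insertNone_empty`, `insertNone_singleton`; `expect_eq_num_div`;
* `pmoment` (`M_s`), `pmoment_empty`, `pmoment_ratio_empty` (on the cube the ratio at `∅` is `1` too), `pmoment_none`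
  (`M_s{none} = ⟨H⟩_s`), `pmoment_some` (`M_s{some i} = −⟨D_i⟩_s`);
* `obs_meas`, `obs_bound`, **`hasDerivAt_pmoment`** (`∂_jM(P) = M(P∪j) − M(P)M{j}`, `j ∉ P̃`);
* **`hasDerivAt_ursell_pmoment`** — THE THEOREM above; `dexp` (`∂Γ⟨H⟩`), `dexp_empty`, **`hasDerivAt_dexp`**
  (`∂/∂s_j|_s ∂Γ⟨H⟩(s[j↦u]) = ∂(Γ∪j)⟨H⟩(s)`, `j ∉ Γ`);
* the low orders in the print's bracket form: `dexp_singleton` (`∂{i}⟨H⟩ = −⟨[D_i;]H⟩`, any `s`) and **`dexp_pair`**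
  (`∂{i,l}⟨H⟩ = −⟨[B_{il};]H⟩ + κ₃(D_i,D_l,H)` = the value of `BIJ88SecondOrder5133.hasDerivAt_dexpect`, by uniqueness of
  derivatives).
HONEST SCOPE.  `H` bounded measurable; real fields, finite dimension; derivatives along coordinate lines at points of the
unit cube; the regrouping into the print's bracket notation and the integration by parts to random walks are NOT here.
NOT summit progress; NOT continuum; NOT Clay.  Imports `BIJ88PairingAllOrders5133`, `LatticeModels.UrsellDerivation`;
modifies nothing.
-/

noncomputable section

namespace Literature.MathematicalPhysics.QuantumFieldTheory.BalabanImbrieJaffe1984to88.BIJ88CumulantAllOrders5133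

open MeasureTheory Matrix Finset Function Filter
open scoped BigOperators Topology
open Literature.Probability.LatticeModels (ursellOf ursellOf_singleton hasDerivAt_ursellOf setPartitions_singleton)
open Literature.MathematicalPhysics.QuantumFieldTheory.Balaban1983to89
open B2Eq228Conditioning (weight source)
open BIJ88DirichletForms305 (interpForm interpForm_posDef)
open BIJ88SDerivative305 (integral_weight_mul_source_pos)
open BIJ88SecondOrder5133 (num Dfun)
open BIJ88PairingAllOrders5133 (smallParts ppoly bvert ppoly_empty bvert_singleton hasDerivAt_num_ppoly num_ppoly_empty)
open BIJ88PairingDisplay305 (expect)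

/-! ## §1  Labels, observables, the normalized moments `M_s` -/

section Defs

variable {α I : Type} [Fintype α] [DecidableEq α] [Fintype I] [DecidableEq I]
  (blk : α → I) (Δ : Matrix α α ℝ)

/-- One cube: `P_{{i}}(s,Φ) = −D_i(s,Φ)`. [cite: BalabanImbrieJaffe1988, §5.13 p.305] -/
theorem ppoly_singleton (s : I → ℝ) (i : I) (φ : α → ℝ) : ppoly blk Δ {i} s φ = -Dfun blk Δ s i φ := by
  have h : smallParts ({i} : Finset I) = {{{i}}} := by
    rw [smallParts, setPartitions_singleton, filter_singleton, if_pos]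
    intro B hB
    rw [mem_singleton.1 hB, card_singleton]
    norm_num
  rw [ppoly, h, sum_singleton, card_singleton, prod_singleton, bvert_singleton]
  ring

omit [Fintype α] [DecidableEq α] [Fintype I] in
/-- The observable attached to a label set: `H` if the label `none` is present, `1` otherwise.
[cite: BalabanImbrieJaffe1988, §5.13 p.305] -/
def obs (H : (α → ℝ) → ℝ) (P : Finset (Option I)) (φ : α → ℝ) : ℝ :=
  if none ∈ P then H φ else 1

omit [Fintype α] [DecidableEq α] [Fintype I] in
/-- [cite: BalabanImbrieJaffe1988, §5.13 p.305] -/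
theorem obs_of_mem {H : (α → ℝ) → ℝ} {P : Finset (Option I)} (h : none ∈ P) : obs H P = H := by
  funext φ
  simp [obs, h]

omit [Fintype α] [DecidableEq α] [Fintype I] in
/-- [cite: BalabanImbrieJaffe1988, §5.13 p.305] -/
theorem obs_of_not_mem {H : (α → ℝ) → ℝ} {P : Finset (Option I)} (h : none ∉ P) : obs H P = fun _ => 1 := by
  funext φ
  simp [obs, h]

omit [Fintype α] [DecidableEq α] [Fintype I] in
/-- A lone cube label carries no observable. [cite: BalabanImbrieJaffe1988, §5.13 p.305] -/
theorem obs_singleton_some (H : (α → ℝ) → ℝ) (j : I) : obs H ({some j} : Finset (Option I)) = fun _ => 1 :=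
  obs_of_not_mem (by simp)

omit [Fintype α] [DecidableEq α] [Fintype I] in
/-- Adding a cube label does not change the observable. [cite: BalabanImbrieJaffe1988, §5.13 p.305] -/
theorem obs_insert_some (H : (α → ℝ) → ℝ) (P : Finset (Option I)) (j : I) :
    obs H (insert (some j) P) = obs H P := by
  funext φ
  simp [obs]

omit [Fintype I] in
/-- `(P ∪ {some j})~ = P̃ ∪ {j}`. [folklore] -/
private theorem eraseNone_insert_some (P : Finset (Option I)) (j : I) :
    eraseNone (insert (some j) P) = insert j (eraseNone P) := by
  ext i
  simp [mem_eraseNone]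

omit [Fintype I] [DecidableEq I] in
/-- `{some j}~ = {j}`. [folklore] -/
private theorem eraseNone_singleton_some (j : I) : eraseNone ({some j} : Finset (Option I)) = {j} := by
  ext i
  simp [mem_eraseNone]

omit [Fintype I] in
/-- `insertNone (Γ ∪ {j}) = insertNone Γ ∪ {some j}`. [folklore] -/
private theorem insertNone_insert (Γ : Finset I) (j : I) :
    insertNone (insert j Γ) = insert (some j) (insertNone Γ) := by
  ext o
  cases o <;> simp

omit [Fintype I] [DecidableEq I] in
/-- `insertNone ∅ = {none}`. [folklore] -/
private theorem insertNone_empty : insertNone (∅ : Finset I) = {none} := by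
  ext o
  cases o <;> simp

omit [Fintype I] in
/-- `insertNone {i} = {some i, none}`. [folklore] -/
private theorem insertNone_singleton (i : I) : insertNone ({i} : Finset I) = {some i, none} := by
  ext o
  cases o <;> simp

omit [Fintype I] in
/-- `{some i, none}~ = {i}`. [folklore] -/
private theorem eraseNone_pair (i : I) : eraseNone ({some i, none} : Finset (Option I)) = {i} := by
  ext a
  simp [mem_eraseNone]

/-- `⟨H⟩_s = N_H(s)/N_1(s)`. [cite: BalabanImbrieJaffe1988, §5.13 p.305] -/
theorem expect_eq_num_div (f : α → ℝ) (H : (α → ℝ) → ℝ) (s : I → ℝ) :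
    expect blk Δ f H s = num blk Δ f H s / num blk Δ f (fun _ => 1) s := by
  simp only [BIJ88PairingDisplay305.expect, num, one_mul]

/-- **The normalized moments of the corrected pairing polynomials with the observable**:
`M_s(P) = ⟨P_{P̃}(s,·) H^{[none∈P]}⟩_s = N(P_{P̃}·obs_P)(s)/N_1(s)`, `P̃ = eraseNone P`; value `1` at `P = ∅` (which is also the
value of the ratio there whenever `N_1(s) ≠ 0`, `pmoment_ratio_empty`). [cite: BalabanImbrieJaffe1988, §5.13 p.305] -/
def pmoment (f : α → ℝ) (H : (α → ℝ) → ℝ) (s : I → ℝ) (P : Finset (Option I)) : ℝ :=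
  if P = ∅ then 1 else
    num blk Δ f (fun φ => ppoly blk Δ (eraseNone P) s φ * obs H P φ) s / num blk Δ f (fun _ => 1) s

/-- `M_s(∅) = 1`. [cite: BalabanImbrieJaffe1988, §5.13 p.305] -/
theorem pmoment_empty (f : α → ℝ) (H : (α → ℝ) → ℝ) (s : I → ℝ) : pmoment blk Δ f H s ∅ = 1 := by
  simp [pmoment]

/-- Off `∅` the moment is the ratio. [cite: BalabanImbrieJaffe1988, §5.13 p.305] -/
theorem pmoment_of_ne_empty (f : α → ℝ) (H : (α → ℝ) → ℝ) (s : I → ℝ) {P : Finset (Option I)} (hP : P ≠ ∅) :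
    pmoment blk Δ f H s P
      = num blk Δ f (fun φ => ppoly blk Δ (eraseNone P) s φ * obs H P φ) s / num blk Δ f (fun _ => 1) s := by
  rw [pmoment, if_neg hP]

variable {Δ} in
/-- On the cube the ratio at `∅` is `1` as well (`N_1(s) > 0`). [cite: BalabanImbrieJaffe1988, §5.13 p.305] -/
theorem pmoment_ratio_empty (hΔ : Δ.PosDef) (f : α → ℝ) (H : (α → ℝ) → ℝ) {s : I → ℝ} (hs : ∀ l, 0 ≤ s l ∧ s l ≤ 1) :
    num blk Δ f (fun φ => ppoly blk Δ (eraseNone (∅ : Finset (Option I))) s φ * obs H (∅ : Finset (Option I)) φ) s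
      / num blk Δ f (fun _ => 1) s = 1 := by
  have hZ0 : num blk Δ f (fun _ => (1:ℝ)) s ≠ 0 := by
    have := integral_weight_mul_source_pos (interpForm_posDef blk hΔ hs) f
    simp only [num, one_mul]
    exact this.ne'
  rw [eraseNone_empty, obs_of_not_mem (Finset.notMem_empty _)]
  simp only [ppoly_empty, mul_one]
  exact div_self hZ0

/-- `M_s{none} = ⟨H⟩_s`. [cite: BalabanImbrieJaffe1988, §5.13 p.305] -/
theorem pmoment_none (f : α → ℝ) (H : (α → ℝ) → ℝ) (s : I → ℝ) :
    pmoment blk Δ f H s {none} = expect blk Δ f H s := by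
  rw [pmoment, if_neg (singleton_ne_empty _), eraseNone_none, obs_of_mem (mem_singleton_self _)]
  simp only [ppoly_empty, one_mul, BIJ88PairingDisplay305.expect, num]

/-- `M_s{some i} = ⟨P_{{i}}⟩_s = −⟨D_i⟩_s` (`= ∂_i log N_1(s)` by p13 g6). [cite: BalabanImbrieJaffe1988, §5.13 p.305] -/
theorem pmoment_some (f : α → ℝ) (H : (α → ℝ) → ℝ) (s : I → ℝ) (i : I) :
    pmoment blk Δ f H s {some i} = -(num blk Δ f (Dfun blk Δ s i) s / num blk Δ f (fun _ => 1) s) := by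
  rw [pmoment, if_neg (singleton_ne_empty _), eraseNone_singleton_some, obs_singleton_some, ← neg_div]
  simp only [ppoly_singleton, mul_one]
  congr 1
  simp only [num, neg_mul, integral_neg]

/-- **The all-orders derivative family of the normalized expectation**: `∂Γ⟨H⟩(s) := Mᵀ_s(insertNone Γ)`, the Ursell
function of the moments `M_s` at the label set `Γ ∪ {none}`. [cite: BalabanImbrieJaffe1988, §5.13 p.305] -/
def dexp (f : α → ℝ) (H : (α → ℝ) → ℝ) (Γ : Finset I) (s : I → ℝ) : ℝ :=
  ursellOf (pmoment blk Δ f H s) (insertNone Γ)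

/-- Order zero: `∂∅⟨H⟩(s) = ⟨H⟩_s`. [cite: BalabanImbrieJaffe1988, §5.13 p.305] -/
theorem dexp_empty (f : α → ℝ) (H : (α → ℝ) → ℝ) (s : I → ℝ) : dexp blk Δ f H ∅ s = expect blk Δ f H s := by
  rw [dexp, insertNone_empty, ursellOf_singleton, pmoment_none]

/-- **Order one** (any `s`): `∂{i}⟨H⟩(s) = Mᵀ_s{some i, none} = ⟨P_iH⟩ − ⟨P_i⟩⟨H⟩ = −(⟨D_iH⟩_s − ⟨D_i⟩_s⟨H⟩_s) = −⟨[D_i;]H⟩_s`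
— the value of p13 g6 `hasDerivAt_expectation_interp` / `BIJ88SecondOrder5133.hasDerivAt_expect`, written in the same
`N`-notation. [cite: BalabanImbrieJaffe1988, §5.13 p.305] -/
theorem dexp_singleton (f : α → ℝ) (H : (α → ℝ) → ℝ) (s : I → ℝ) (i : I) :
    dexp blk Δ f H {i} s
      = -(num blk Δ f (fun φ => Dfun blk Δ s i φ * H φ) s / num blk Δ f (fun _ => 1) s
          - num blk Δ f (Dfun blk Δ s i) s / num blk Δ f (fun _ => 1) s
            * (num blk Δ f H s / num blk Δ f (fun _ => 1) s)) := by
  rw [dexp, insertNone_singleton,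
    Literature.Probability.LatticeModels.ursellOf_pair (pmoment blk Δ f H s) (pmoment_empty blk Δ f H s)
      (Option.some_ne_none i),
    pmoment_of_ne_empty blk Δ f H s (insert_ne_empty _ _), eraseNone_pair, obs_of_mem (by simp), pmoment_some,
    pmoment_none, expect_eq_num_div]
  simp only [ppoly_singleton]
  have h : num blk Δ f (fun φ => -Dfun blk Δ s i φ * H φ) s = -num blk Δ f (fun φ => Dfun blk Δ s i φ * H φ) s := by
    simp only [num, neg_mul, integral_neg]
  rw [h]
  ring

end Defs

/-! ## §2  The theorem -/

section Main

variable {α I : Type} [Fintype α] [DecidableEq α] [Fintype I] [DecidableEq I] (blk : α → I)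
  {Δ : Matrix α α ℝ} (hΔ : Δ.PosDef) {c C : ℝ} (hc : 0 < c)
  (hcΔ : ∀ v, c * (v ⬝ᵥ v) ≤ v ⬝ᵥ (Δ *ᵥ v)) (hCΔ : ∀ v, v ⬝ᵥ (Δ *ᵥ v) ≤ C * (v ⬝ᵥ v))
  {s : I → ℝ} (hs : ∀ l, 0 ≤ s l ∧ s l ≤ 1) (j : I) (f : α → ℝ)
  {H : (α → ℝ) → ℝ} (hHm : AEStronglyMeasurable H volume) {K₀ : ℝ} (hK : ∀ φ, ‖H φ‖ ≤ K₀)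

omit [DecidableEq α] [Fintype I] in
include hHm in
/-- [cite: BalabanImbrieJaffe1988, §5.13 p.305] -/
theorem obs_meas (P : Finset (Option I)) : AEStronglyMeasurable (obs H P) volume := by
  by_cases hP : none ∈ P
  · rw [obs_of_mem hP]; exact hHm
  · rw [obs_of_not_mem hP]; exact aestronglyMeasurable_const

omit [Fintype α] [DecidableEq α] [Fintype I] in
include hK in
/-- [cite: BalabanImbrieJaffe1988, §5.13 p.305] -/
theorem obs_bound (P : Finset (Option I)) : ∀ φ, ‖obs H P φ‖ ≤ max K₀ 1 := fun φ => by
  by_cases hP : none ∈ P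
  · rw [obs_of_mem hP]; exact (hK φ).trans (le_max_left _ _)
  · rw [obs_of_not_mem hP]; simp

include hΔ hc hcΔ hCΔ hs hHm hK in
/-- **The quotient rule for the moments**: for `s ∈ [0,1]^I` and `j ∉ P̃`,
`∂/∂s_j|_s M_{s[j↦u]}(P) = M_s(P ∪ {some j}) − M_s(P)M_s{some j}` (from `∂_j N(P_Γ G) = N(P_{Γ∪j}G)` for `G = obs_P` and
`G = 1`). [cite: BalabanImbrieJaffe1988, §5.13 p.305] -/
theorem hasDerivAt_pmoment (P : Finset (Option I)) (hjP : some j ∉ P) :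
    HasDerivAt (fun u => pmoment blk Δ f H (update s j u) P)
      (pmoment blk Δ f H s (insert (some j) P) - pmoment blk Δ f H s P * pmoment blk Δ f H s {some j}) (s j) := by
  by_cases hP : P = ∅
  · subst hP
    simp only [pmoment_empty, insert_empty, one_mul, sub_self]
    exact hasDerivAt_const _ _
  have hZ0 : num blk Δ f (fun _ => (1:ℝ)) s ≠ 0 := by
    have := integral_weight_mul_source_pos (interpForm_posDef blk hΔ hs) f
    simp only [num, one_mul]
    exact this.ne'
  have hj' : j ∉ eraseNone P := fun h => hjP (mem_eraseNone.1 h)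
  have hN := hasDerivAt_num_ppoly blk hΔ hc hcΔ hCΔ hs hj' f (obs_meas hHm P) (obs_bound hK P)
  have hZ := hasDerivAt_num_ppoly blk hΔ hc hcΔ hCΔ hs (Finset.notMem_empty j) f (H := fun _ => (1:ℝ))
    aestronglyMeasurable_const (K₀ := 1) (fun _ => by simp)
  simp only [num_ppoly_empty, insert_empty] at hZ
  have hZ0' : num blk Δ f (fun _ => (1:ℝ)) (update s j (s j)) ≠ 0 := by
    rwa [update_eq_self]
  have key := hN.div hZ hZ0'
  have hfun : (fun u => pmoment blk Δ f H (update s j u) P) = fun u =>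
      num blk Δ f (fun φ => ppoly blk Δ (eraseNone P) (update s j u) φ * obs H P φ) (update s j u)
        / num blk Δ f (fun _ => 1) (update s j u) := by
    funext u
    rw [pmoment, if_neg hP]
  rw [hfun]
  refine key.congr_deriv ?_
  rw [update_eq_self, pmoment_of_ne_empty blk Δ f H s (insert_ne_empty _ _), pmoment_of_ne_empty blk Δ f H s hP,
    pmoment_of_ne_empty blk Δ f H s (singleton_ne_empty _), eraseNone_insert_some, obs_insert_some,
    eraseNone_singleton_some, obs_singleton_some]
  simp only [mul_one]
  field_simp

include hΔ hc hcΔ hCΔ hs hHm hK in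
/-- **THE `s`-DERIVATIVES OF THE TRUNCATED FUNCTIONS AT EVERY ORDER**: for `s ∈ [0,1]^I`, a nonempty label set `W` with
`some j ∉ W`, and `H` bounded measurable,
`∂/∂s_j|_s Mᵀ_{s[j↦u]}(W) = Mᵀ_s(W ∪ {some j})` — differentiating along `s_j` inserts the cube `j` as one more truncated
argument (`LatticeModels.hasDerivAt_ursellOf` fed with `hasDerivAt_pmoment`). [cite: BalabanImbrieJaffe1988, §5.13 p.305] -/
theorem hasDerivAt_ursell_pmoment {W : Finset (Option I)} (hW : W.Nonempty) (hjW : some j ∉ W) :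
    HasDerivAt (fun u => ursellOf (pmoment blk Δ f H (update s j u)) W)
      (ursellOf (pmoment blk Δ f H s) (insert (some j) W)) (s j) := by
  have h := hasDerivAt_ursellOf (𝕜 := ℝ) (fun P u => pmoment blk Δ f H (update s j u) P) (some j) (s j)
    (fun u => pmoment_empty blk Δ f H _) (fun P hP => by
      have h1 := hasDerivAt_pmoment blk hΔ hc hcΔ hCΔ hs j f hHm hK P hP
      simp only [update_eq_self]
      exact h1) hjW hW
  simp only [update_eq_self] at h
  exact h

include hΔ hc hcΔ hCΔ hs hHm hK in
/-- **`∂/∂s_Γ⟨H⟩_s` AT EVERY ORDER** (the corrected p. 305 display, normalized, before integration by parts): for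
`s ∈ [0,1]^I` and `j ∉ Γ`, `∂/∂s_j|_s ∂Γ⟨H⟩(s[j↦u]) = ∂(Γ∪j)⟨H⟩(s)`; with `dexp_empty` (`∂∅⟨H⟩ = ⟨H⟩_s`) the family
`Γ ↦ ∂Γ⟨H⟩(s) = Mᵀ_s(Γ ∪ {H}) = Σ_{π ∈ setPartitions(Γ∪{H})}(−1)^{|π|−1}(|π|−1)! Π_{P∈π}⟨P_{P̃}H^{[H∈P]}⟩_s` is the family of
iterated coordinate derivatives of `⟨H⟩_s` on the cube, `P_Γ` the corrected pairing polynomial (all set partitions of `Γ`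
into blocks of ≤ 2 cubes; the print keeps the pairings). [cite: BalabanImbrieJaffe1988, §5.13 p.305] -/
theorem hasDerivAt_dexp {Γ : Finset I} (hj : j ∉ Γ) :
    HasDerivAt (fun u => dexp blk Δ f H Γ (update s j u)) (dexp blk Δ f H (insert j Γ) s) (s j) := by
  have h := hasDerivAt_ursell_pmoment blk hΔ hc hcΔ hCΔ hs j f hHm hK (W := insertNone Γ) insertNone_nonempty
    (fun h => hj (some_mem_insertNone.1 h))
  simp only [dexp, insertNone_insert]
  exact h

include hΔ hc hcΔ hCΔ hs hHm hK in
/-- **Order two** (`s ∈ [0,1]^I`, `i ≠ l`): `∂{i,l}⟨H⟩(s) = Mᵀ_s{some i, some l, none}` IS the corrected second-order value of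
`BIJ88SecondOrder5133.hasDerivAt_dexpect`, `−⟨[B_{il};]H⟩_s + κ₃(D_i,D_l,H)_s` (the pairing term AND the third truncation; in
print's signs `⟨[V_{il};]H⟩ + ⟨[D_i;][D_l;]H⟩`) — by uniqueness of the derivative of the common function `u ↦ ∂{i}⟨H⟩(s[l↦u])`
(`dexp_singleton`, `hasDerivAt_dexp`).  The Ursell form reproduces the print's brackets at orders one and two.
[cite: BalabanImbrieJaffe1988, §5.13 p.305] -/
theorem dexp_pair {i l : I} (hil : i ≠ l) :
    dexp blk Δ f H {i, l} s
      = -(num blk Δ f (fun φ => BIJ88DirichletDeriv305.blockPair blk Δ φ i l * H φ) s / num blk Δ f (fun _ => 1) s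
          - num blk Δ f (fun φ => BIJ88DirichletDeriv305.blockPair blk Δ φ i l) s / num blk Δ f (fun _ => 1) s
            * (num blk Δ f H s / num blk Δ f (fun _ => 1) s))
        + (num blk Δ f (fun φ => Dfun blk Δ s i φ * Dfun blk Δ s l φ * H φ) s / num blk Δ f (fun _ => 1) s
          - num blk Δ f (Dfun blk Δ s i) s / num blk Δ f (fun _ => 1) s
            * (num blk Δ f (fun φ => Dfun blk Δ s l φ * H φ) s / num blk Δ f (fun _ => 1) s)
          - num blk Δ f (Dfun blk Δ s l) s / num blk Δ f (fun _ => 1) s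
            * (num blk Δ f (fun φ => Dfun blk Δ s i φ * H φ) s / num blk Δ f (fun _ => 1) s)
          - num blk Δ f (fun φ => Dfun blk Δ s i φ * Dfun blk Δ s l φ) s / num blk Δ f (fun _ => 1) s
            * (num blk Δ f H s / num blk Δ f (fun _ => 1) s)
          + 2 * (num blk Δ f (Dfun blk Δ s i) s / num blk Δ f (fun _ => 1) s)
            * (num blk Δ f (Dfun blk Δ s l) s / num blk Δ f (fun _ => 1) s)
            * (num blk Δ f H s / num blk Δ f (fun _ => 1) s)) := by
  have h1 := hasDerivAt_dexp blk hΔ hc hcΔ hCΔ hs l f hHm hK (Γ := {i}) (fun h => hil (mem_singleton.1 h).symm)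
  have h2 := BIJ88SecondOrder5133.hasDerivAt_dexpect blk hΔ hc hcΔ hCΔ hs hil f hHm hK
  have hfun : (fun u => dexp blk Δ f H {i} (update s l u)) = fun u =>
      -(num blk Δ f (fun φ => Dfun blk Δ (update s l u) i φ * H φ) (update s l u)
            / num blk Δ f (fun _ => 1) (update s l u)
          - num blk Δ f (Dfun blk Δ (update s l u) i) (update s l u) / num blk Δ f (fun _ => 1) (update s l u)
            * (num blk Δ f H (update s l u) / num blk Δ f (fun _ => 1) (update s l u))) := by
    funext u
    exact dexp_singleton blk Δ f H (update s l u) i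
  rw [hfun] at h1
  rw [pair_comm]
  exact h1.unique h2

end Main

end Literature.MathematicalPhysics.QuantumFieldTheory.BalabanImbrieJaffe1984to88.BIJ88CumulantAllOrders5133
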